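import Summits.RiemannHypothesis.RiemannHypothesis.Theses.SignCone
import Summits.RiemannHypothesis.RiemannHypothesis.Theorems.SignConeConeMagnificationCompactness
import Literature.NumberTheory.LFunctions.WeilExplicit
import Literature.NumberTheory.LFunctions.GeneralizedRH

/-!
# Stub `stub_deficitOfTorus` of line `Sketch` for crux `SignCone.ConeMagnification`
(item stmt-RiemannHypothesis-16303, route route-RiemannHypothesis-SignCone)

TORUS INEQUALITY ⇒ DEFICIT SUMMABILITY (the finite spine of W-MAG Thm 1.2(i)).  Let `c ≥ 0` be a
weight on `ℕ` such that for every finite set `S` of primes and every phase `φ`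
`Σ_{A ⊆ S} (c(n_A) − Λ(n_A)) n_A^{-1/2} 2^{-|A|} cos(|A| φ) ≤ 1/2`, `n_A = Π_{p ∈ A} p`.  Then
`Σ_p (log p − c(p))₊ p^{-σ} < ∞` for every `σ > 1/2`.

Proof.  KEY FINITE BOUND: for every finite set `T` of primes, `Σ_{p ∈ T} (log p − c(p))₊ /√p ≤ 2`.
Indeed, let `S ⊆ T` be the deficit primes (`c(p) < log p`); off `S` the summand vanishes.  Apply the
torus inequality to `S` and regroup by `k = |A|` (`Finset.powerset_card_disjiUnion`): the left side is a
cosine polynomial `Σ_{k ≤ |S|} a_k cos(kφ)` with `a₀ = c(1) ≥ 0` (as `Λ(1) = 0`) and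
`a₁ = ½ Σ_{p ∈ S} (c(p) − log p)/√p = −½ Σ_{p ∈ S} (log p − c(p))₊/√p`.  So
`β₀ + Σ_{k ≥ 1} β_k cos(kφ) ≥ 0` for all `φ` with `β₀ = 1/2 − c(1)`, `β_k = −a_k`; the Fejér step
`|β₁| ≤ 2β₀` (proved by exact quadrature at the `(|S|+2)`-th roots of unity, adapted from the 2001
stockroom file `Rh_WMagnificationY1_MagDeficit`) gives `½ Σ_{p∈S} (log p − c(p))₊/√p ≤ 1 − 2c(1) ≤ 1`.
SUMMABILITY: for a prime `p` and `σ > 1/2`, `p^σ ≥ √p`, so the target series is dominated termwise by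
`p ↦ 𝟙_{p prime} (log p − c(p))₊/√p ≥ 0`, all of whose finite partial sums are `≤ 2`
(`summable_of_sum_le`, `Summable.of_nonneg_of_le`).
-/

noncomputable section

-- `Summit.RiemannHypothesis.RiemannHypothesis.…` repeats a namespace component by design (D-0017 layout).
set_option linter.dupNamespace false

open scoped BigOperators ComplexConjugate Topology
open Complex MeasureTheory Set Filter

namespace Summit.RiemannHypothesis.RiemannHypothesis.Theorems.SignConeConeMagnification

open Literature.NumberTheory.LFunctions
open Summit.RiemannHypothesis.RiemannHypothesis.Theorems.SignCone

/-! ## Discrete orthogonality and the Fejér step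

The step "`g` is a nonnegative cosine polynomial of degree `n`, so `|ĝ(1)| ≤ 2 ĝ(0)`" is carried out
by exact quadrature at the `N`-th roots of unity, `N = n + 2` — a finite identity, no integration. -/

-- adapted from reserve/prior-2001/Prior/RiemannHypothesis/RiemannHypothesis/Rh_WMagnificationY1_MagDeficit.lean (2001 programme)
/-- Discrete orthogonality: `Σ_{j<N} cos(2πjm/N) = 0` when `N ∤ m` (real part of the geometric sum of
the `N`-th roots of unity). [folklore] -/
theorem fejer_sum_cos_roots_eq_zero {N m : ℕ} (hN : 0 < N) (hm : ¬ N ∣ m) :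
    ∑ j ∈ Finset.range N, Real.cos (2 * Real.pi * j * m / N) = 0 := by
  have hNne : (N : ℂ) ≠ 0 := Nat.cast_ne_zero.mpr hN.ne'
  have hω : Complex.exp (2 * Real.pi * Complex.I * m / N) ≠ 1 := fun h1 =>
    hm ((Complex.exp_two_pi_mul_I_mul_div_eq_one_iff hN.ne').mp h1)
  have hgeom : ∑ j ∈ Finset.range N, Complex.exp (2 * Real.pi * Complex.I * m / N) ^ j = 0 := by
    have hpow : Complex.exp (2 * Real.pi * Complex.I * m / N) ^ N = 1 := by
      rw [← Complex.exp_nat_mul]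
      have harg : (N : ℂ) * (2 * Real.pi * Complex.I * m / N)
          = (m : ℂ) * (2 * Real.pi * Complex.I) := by
        rw [mul_comm ((N : ℂ)) _, div_mul_cancel₀ _ hNne]
        ring
      rw [harg]
      exact Complex.exp_nat_mul_two_pi_mul_I m
    rw [geom_sum_eq hω, hpow, sub_self, zero_div]
  have hterm : ∀ j : ℕ,
      (Complex.exp (2 * Real.pi * Complex.I * m / N) ^ j).re
        = Real.cos (2 * Real.pi * j * m / N) := by
    intro j
    rw [← Complex.exp_nat_mul]
    rw [show (j : ℂ) * (2 * Real.pi * Complex.I * m / N)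
        = ((2 * Real.pi * j * m / N : ℝ) : ℂ) * Complex.I by push_cast; ring]
    exact Complex.exp_ofReal_mul_I_re _
  calc ∑ j ∈ Finset.range N, Real.cos (2 * Real.pi * j * m / N)
      = ∑ j ∈ Finset.range N, (Complex.exp (2 * Real.pi * Complex.I * m / N) ^ j).re :=
        Finset.sum_congr rfl fun j _ => (hterm j).symm
    _ = (∑ j ∈ Finset.range N, Complex.exp (2 * Real.pi * Complex.I * m / N) ^ j).re :=
        (Complex.re_sum _ _).symm
    _ = 0 := by rw [hgeom, Complex.zero_re]

-- adapted from reserve/prior-2001/Prior/RiemannHypothesis/RiemannHypothesis/Rh_WMagnificationY1_MagDeficit.lean (2001 programme)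
/-- The same sum for `N ∣ m`: all the cosines are cosines of multiples of `2π`, so the sum is `N`.
[folklore] -/
theorem fejer_sum_cos_roots_of_dvd {N m : ℕ} (hm : N ∣ m) :
    ∑ j ∈ Finset.range N, Real.cos (2 * Real.pi * j * m / N) = N := by
  rcases Nat.eq_zero_or_pos N with hN | hN
  · subst hN; simp
  obtain ⟨t, rfl⟩ := hm
  have hNne : (N : ℝ) ≠ 0 := Nat.cast_ne_zero.mpr hN.ne'
  have hone : ∀ j ∈ Finset.range N, Real.cos (2 * Real.pi * j * ((N * t : ℕ) : ℝ) / N) = 1 := by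
    intro j _
    have harg : 2 * Real.pi * j * ((N * t : ℕ) : ℝ) / N = ((j * t : ℕ) : ℝ) * (2 * Real.pi) := by
      push_cast
      field_simp
    rw [harg]
    exact Real.cos_nat_mul_two_pi (j * t)
  rw [Finset.sum_congr rfl hone, Finset.sum_const, Finset.card_range, nsmul_eq_mul, mul_one]

-- adapted from reserve/prior-2001/Prior/RiemannHypothesis/RiemannHypothesis/Rh_WMagnificationY1_MagDeficit.lean (2001 programme)
/-- The Fejér step, discretely: if the cosine polynomial `φ ↦ Σ_{k ≤ n} β_k cos(kφ)` (`n ≥ 1`) is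
everywhere nonnegative then `|β₁| ≤ 2 β₀` (sample at the `(n+2)`-th roots of unity: the plain sample sum
is `(n+2) β₀`, the `cos`-weighted one is `(n+2) β₁ / 2`, and `|cos| ≤ 1`). [folklore] -/
theorem fejer_abs_coeff_one_le_two_mul_coeff_zero {n : ℕ} (hn : 1 ≤ n) (β : ℕ → ℝ)
    (h : ∀ φ : ℝ, 0 ≤ ∑ k ∈ Finset.range (n + 1), β k * Real.cos (k * φ)) :
    |β 1| ≤ 2 * β 0 := by
  set N := n + 2 with hNdef
  have hNpos : 0 < N := Nat.succ_pos _
  have hNR : (0 : ℝ) < N := by exact_mod_cast hNpos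
  -- the sample angles
  set φj : ℕ → ℝ := fun j => 2 * Real.pi * j / N with hφj
  -- master sample-sum computation, for any frequency m ≤ n + 1
  have hsum : ∀ m : ℕ, m ≤ n + 1 →
      ∑ j ∈ Finset.range N, Real.cos ((m : ℝ) * φj j)
        = if m = 0 then (N : ℝ) else 0 := by
    intro m hm
    have hangle : ∀ j : ℕ, (m : ℝ) * φj j = 2 * Real.pi * j * m / N := by
      intro j; simp only [hφj]; ring
    rw [Finset.sum_congr rfl fun j _ => by rw [hangle]]
    rcases Nat.eq_zero_or_pos m with hm0 | hmpos
    · subst hm0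
      rw [if_pos rfl]
      exact fejer_sum_cos_roots_of_dvd (dvd_zero N)
    · rw [if_neg hmpos.ne']
      refine fejer_sum_cos_roots_eq_zero hNpos fun hdvd => ?_
      have : N ≤ m := Nat.le_of_dvd hmpos hdvd
      omega
  -- S0 = Σ_j g(φj j) = N β₀
  have hS0 : ∑ j ∈ Finset.range N, (∑ k ∈ Finset.range (n + 1), β k * Real.cos ((k : ℝ) * φj j))
      = (N : ℝ) * β 0 := by
    rw [Finset.sum_comm]
    have h1 : ∀ k ∈ Finset.range (n + 1),
        ∑ j ∈ Finset.range N, β k * Real.cos ((k : ℝ) * φj j)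
          = if k = 0 then β k * (N : ℝ) else 0 := by
      intro k hk
      rw [← Finset.mul_sum,
        hsum k ((Nat.lt_succ_iff.mp (Finset.mem_range.mp hk)).trans (Nat.le_succ n)),
        mul_ite, mul_zero]
    rw [Finset.sum_congr rfl h1, Finset.sum_ite_eq' (Finset.range (n + 1)) 0
      (fun k => β k * (N : ℝ)), if_pos (Finset.mem_range.mpr (Nat.succ_pos n))]
    ring
  -- the product-to-sum identity
  have hcoscos : ∀ x y : ℝ, Real.cos x * Real.cos y
      = (Real.cos (x + y) + Real.cos (x - y)) / 2 := by
    intro x y; rw [Real.cos_add, Real.cos_sub]; ring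
  -- S1 = Σ_j g(φj j) cos(φj j) = (N/2) β₁
  have hinner2 : ∀ k : ℕ, k ∈ Finset.range (n + 1) →
      ∑ j ∈ Finset.range N, Real.cos ((k : ℝ) * φj j) * Real.cos (φj j)
        = if k = 1 then (N : ℝ) / 2 else 0 := by
    intro k hk
    have hk' : k ≤ n := Nat.lt_succ_iff.mp (Finset.mem_range.mp hk)
    have hplus : ∑ j ∈ Finset.range N, Real.cos (((k : ℝ) + 1) * φj j) = 0 := by
      have hcast : ((k + 1 : ℕ) : ℝ) = (k : ℝ) + 1 := by push_cast; ring
      rw [Finset.sum_congr rfl fun j _ => by rw [← hcast]]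
      rw [hsum (k + 1) (by omega)]
      simp
    have hminus : ∑ j ∈ Finset.range N, Real.cos (((k : ℝ) - 1) * φj j)
        = if k = 1 then (N : ℝ) else 0 := by
      rcases Nat.eq_zero_or_pos k with hk0 | hkpos
      · subst hk0
        have h0 : ∀ j ∈ Finset.range N, Real.cos ((((0 : ℕ) : ℝ) - 1) * φj j)
            = Real.cos (((1 : ℕ) : ℝ) * φj j) := by
          intro j _
          have harg : (((0 : ℕ) : ℝ) - 1) * φj j = -((((1 : ℕ)) : ℝ) * φj j) := by
            push_cast
            ring
          rw [harg, Real.cos_neg]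
        rw [Finset.sum_congr rfl h0, hsum 1 (by omega)]
        norm_num
      · have hcast : ((k - 1 : ℕ) : ℝ) = (k : ℝ) - 1 := by
          push_cast [Nat.cast_sub hkpos]
          ring
        rw [Finset.sum_congr rfl fun j _ => by rw [← hcast]]
        rw [hsum (k - 1) (by omega)]
        rcases eq_or_ne k 1 with hk1 | hk1
        · subst hk1; simp
        · rw [if_neg (by omega), if_neg hk1]
    calc ∑ j ∈ Finset.range N, Real.cos ((k : ℝ) * φj j) * Real.cos (φj j)
        = ∑ j ∈ Finset.range N,
            ((Real.cos (((k : ℝ) + 1) * φj j) + Real.cos (((k : ℝ) - 1) * φj j)) / 2) := by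
          refine Finset.sum_congr rfl fun j _ => ?_
          rw [hcoscos]
          congr 2 <;> ring
      _ = (∑ j ∈ Finset.range N, Real.cos (((k : ℝ) + 1) * φj j)
            + ∑ j ∈ Finset.range N, Real.cos (((k : ℝ) - 1) * φj j)) / 2 := by
          rw [← Finset.sum_add_distrib, ← Finset.sum_div]
      _ = if k = 1 then (N : ℝ) / 2 else 0 := by
          rw [hplus, hminus]
          rcases eq_or_ne k 1 with hk1 | hk1
          · rw [if_pos hk1, if_pos hk1]; ring
          · rw [if_neg hk1, if_neg hk1]; ring
  have hS1 : ∑ j ∈ Finset.range N,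
      (∑ k ∈ Finset.range (n + 1), β k * Real.cos ((k : ℝ) * φj j)) * Real.cos (φj j)
        = (N : ℝ) / 2 * β 1 := by
    have hexp : ∀ j ∈ Finset.range N,
        (∑ k ∈ Finset.range (n + 1), β k * Real.cos ((k : ℝ) * φj j)) * Real.cos (φj j)
          = ∑ k ∈ Finset.range (n + 1), β k * (Real.cos ((k : ℝ) * φj j) * Real.cos (φj j)) := by
      intro j _
      rw [Finset.sum_mul]
      exact Finset.sum_congr rfl fun k _ => by ring
    rw [Finset.sum_congr rfl hexp, Finset.sum_comm]
    have h1 : ∀ k ∈ Finset.range (n + 1),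
        ∑ j ∈ Finset.range N, β k * (Real.cos ((k : ℝ) * φj j) * Real.cos (φj j))
          = if k = 1 then β k * ((N : ℝ) / 2) else 0 := by
      intro k hk
      rw [← Finset.mul_sum, hinner2 k hk, mul_ite, mul_zero]
    rw [Finset.sum_congr rfl h1, Finset.sum_ite_eq' (Finset.range (n + 1)) 1
      (fun k => β k * ((N : ℝ) / 2)), if_pos (Finset.mem_range.mpr (by omega))]
    ring
  -- bound |S1| ≤ S0 using nonnegativity of the samples and |cos| ≤ 1
  have hbound : |(N : ℝ) / 2 * β 1| ≤ (N : ℝ) * β 0 := by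
    rw [← hS1, ← hS0]
    refine (Finset.abs_sum_le_sum_abs _ _).trans ?_
    refine Finset.sum_le_sum fun j _ => ?_
    rw [abs_mul]
    have hg : 0 ≤ ∑ k ∈ Finset.range (n + 1), β k * Real.cos ((k : ℝ) * φj j) := h (φj j)
    rw [abs_of_nonneg hg]
    exact mul_le_of_le_one_right hg (Real.abs_cos_le_one _)
  have habs : |β 1| * ((N : ℝ) / 2) ≤ 2 * β 0 * ((N : ℝ) / 2) := by
    have h2 : |(N : ℝ) / 2 * β 1| = |β 1| * ((N : ℝ) / 2) := by
      rw [abs_mul, abs_of_nonneg (by positivity : (0 : ℝ) ≤ (N : ℝ) / 2), mul_comm]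
    calc |β 1| * ((N : ℝ) / 2) = |(N : ℝ) / 2 * β 1| := h2.symm
      _ ≤ (N : ℝ) * β 0 := hbound
      _ = 2 * β 0 * ((N : ℝ) / 2) := by ring
  exact le_of_mul_le_mul_right habs (by positivity)

/-! ## The key finite bound: `Σ_{p ∈ T} (log p − c(p))₊ /√p ≤ 2` -/

/-- Regrouping a sum over the powerset by cardinality: if the summand is `e A · cos(|A| φ)` then
`Σ_{A ⊆ S} e A cos(|A|φ) = Σ_{k ≤ |S|} (Σ_{A ⊆ S, |A| = k} e A) cos(kφ)`. [folklore] -/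
theorem sum_powerset_mul_cos_card (S : Finset ℕ) (e : Finset ℕ → ℝ) (φ : ℝ) :
    ∑ A ∈ S.powerset, e A * Real.cos ((A.card : ℝ) * φ) =
      ∑ k ∈ Finset.range (S.card + 1), (∑ A ∈ S.powersetCard k, e A) * Real.cos ((k : ℝ) * φ) := by
  rw [Finset.powerset_card_disjiUnion, Finset.sum_disjiUnion]
  refine Finset.sum_congr rfl fun k _ => ?_
  rw [Finset.sum_mul]
  refine Finset.sum_congr rfl fun A hA => ?_
  rw [(Finset.mem_powersetCard.mp hA).2]

/-- On the deficit primes the torus inequality bounds the deficit: if every element of `S` is a prime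
with `c(p) < log p`, then `Σ_{p ∈ S} (log p − c(p))₊ /√p ≤ 2`.  Regroup the torus inequality by `|A|`
into a nonnegative cosine polynomial with `β₀ = 1/2 − c(1)`, `β₁ = ½ Σ_{p∈S} (log p − c(p))₊/√p` and
apply the discrete Fejér step `|β₁| ≤ 2β₀ ≤ 1`. [folklore] -/
theorem sum_deficit_div_sqrt_le_two_of_lt (c : ℕ → ℝ) (hc : ∀ n, 0 ≤ c n)
    (hT : ∀ S : Finset ℕ, (∀ p ∈ S, p.Prime) → ∀ φ : ℝ,
        ∑ A ∈ S.powerset, (c (∏ p ∈ A, p) - ArithmeticFunction.vonMangoldt (∏ p ∈ A, p)) /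
            Real.sqrt (∏ p ∈ A, (p : ℝ)) * (1 / 2) ^ A.card * Real.cos ((A.card : ℝ) * φ) ≤ 1 / 2)
    (S : Finset ℕ) (hS : ∀ p ∈ S, p.Prime) (hlt : ∀ p ∈ S, c p < Real.log p) :
    ∑ p ∈ S, max (Real.log p - c p) 0 / Real.sqrt p ≤ 2 := by
  rcases S.eq_empty_or_nonempty with hSe | hSne
  · subst hSe; simp
  -- the `φ`-free coefficients
  set e : Finset ℕ → ℝ := fun A =>
    (c (∏ p ∈ A, p) - ArithmeticFunction.vonMangoldt (∏ p ∈ A, p)) /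
      Real.sqrt (∏ p ∈ A, (p : ℝ)) * (1 / 2) ^ A.card with he
  set β : ℕ → ℝ := fun k => (if k = 0 then 1 / 2 else 0) - ∑ A ∈ S.powersetCard k, e A with hβ
  -- the cosine polynomial with coefficients β is everywhere nonnegative
  have hpos : ∀ φ : ℝ, 0 ≤ ∑ k ∈ Finset.range (S.card + 1), β k * Real.cos (k * φ) := by
    intro φ
    have hdesign := hT S hS φ
    have hgroup := sum_powerset_mul_cos_card S e φ
    have hexp : ∑ k ∈ Finset.range (S.card + 1), β k * Real.cos (k * φ)
        = 1 / 2 - ∑ k ∈ Finset.range (S.card + 1),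
            (∑ A ∈ S.powersetCard k, e A) * Real.cos (k * φ) := by
      have h1 : ∀ k ∈ Finset.range (S.card + 1),
          β k * Real.cos (k * φ)
            = (if k = 0 then 1 / 2 * Real.cos (k * φ) else 0)
              - (∑ A ∈ S.powersetCard k, e A) * Real.cos (k * φ) := by
        intro k _
        simp only [hβ]
        rw [sub_mul, ite_mul, zero_mul]
      rw [Finset.sum_congr rfl h1, Finset.sum_sub_distrib]
      congr 1
      rw [Finset.sum_ite_eq' (Finset.range (S.card + 1)) 0
        (fun k => 1 / 2 * Real.cos (k * φ)), if_pos (Finset.mem_range.mpr (Nat.succ_pos _))]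
      norm_num
    rw [hexp, ← hgroup]
    linarith
  -- Fejér
  have hfejer := fejer_abs_coeff_one_le_two_mul_coeff_zero (Finset.Nonempty.card_pos hSne) β hpos
  -- compute β 0 and β 1
  have hβ0 : β 0 = 1 / 2 - c 1 := by
    simp only [hβ, he, if_true, Finset.powersetCard_zero, Finset.sum_singleton, Finset.prod_empty,
      Finset.card_empty, pow_zero, mul_one, ArithmeticFunction.vonMangoldt_apply_one, sub_zero,
      Real.sqrt_one, div_one]
  have hβ1 : β 1 = (1 / 2) * ∑ p ∈ S, max (Real.log p - c p) 0 / Real.sqrt p := by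
    simp only [hβ, he, one_ne_zero, if_false, Finset.powersetCard_one, Finset.sum_map,
      Function.Embedding.coeFn_mk, Finset.prod_singleton, Finset.card_singleton, pow_one, zero_sub]
    rw [Finset.mul_sum, ← Finset.sum_neg_distrib]
    refine Finset.sum_congr rfl fun p hp => ?_
    rw [ArithmeticFunction.vonMangoldt_apply_prime (hS p hp),
      max_eq_left (sub_pos.mpr (hlt p hp)).le]
    ring
  rw [hβ0, hβ1, abs_of_nonneg (mul_nonneg (by norm_num) (Finset.sum_nonneg fun p _ =>
    div_nonneg (le_max_right _ _) (Real.sqrt_nonneg _)))] at hfejer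
  have hc1 := hc 1
  linarith

/-- The key finite bound: for every finite set `T` of primes, `Σ_{p ∈ T} (log p − c(p))₊ /√p ≤ 2`
(restrict to the deficit primes `c(p) < log p`, where the previous lemma applies; elsewhere the summand
vanishes). [folklore] -/
theorem sum_deficit_div_sqrt_le_two (c : ℕ → ℝ) (hc : ∀ n, 0 ≤ c n)
    (hT : ∀ S : Finset ℕ, (∀ p ∈ S, p.Prime) → ∀ φ : ℝ,
        ∑ A ∈ S.powerset, (c (∏ p ∈ A, p) - ArithmeticFunction.vonMangoldt (∏ p ∈ A, p)) /
            Real.sqrt (∏ p ∈ A, (p : ℝ)) * (1 / 2) ^ A.card * Real.cos ((A.card : ℝ) * φ) ≤ 1 / 2)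
    (T : Finset ℕ) (hTp : ∀ p ∈ T, p.Prime) :
    ∑ p ∈ T, max (Real.log p - c p) 0 / Real.sqrt p ≤ 2 := by
  classical
  have hne : ∀ p ∈ T, max (Real.log p - c p) 0 / Real.sqrt p ≠ 0 → c p < Real.log p := by
    intro p _ h
    by_contra hle
    exact h (by rw [max_eq_right (sub_nonpos.mpr (not_lt.mp hle)), zero_div])
  rw [← Finset.sum_filter_of_ne hne]
  exact sum_deficit_div_sqrt_le_two_of_lt c hc hT _
    (fun p hp => hTp p (Finset.mem_filter.mp hp).1) (fun p hp => (Finset.mem_filter.mp hp).2)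

/-! ## The stub -/

/-- **Stub 4b — `deficitOfTorus` (the finite spine of W-MAG Thm 1.2(i): torus inequality ⇒ deficit
summability).**  If `c ≥ 0` satisfies the torus inequality of `stub_torusIneq` for every finite set of primes
and every phase, then `Σ_p (log p − c(p))₊ p^{-σ} < ∞` for every `σ > 1/2` — indeed the partial sums of
`Σ_p (log p − c(p))₊ /√p` are `≤ 2`: apply the inequality to the DEFICIT primes `S` of a finite set (there
`(c − Λ)(p) = −(log p − c(p))₊`), regroup by `k = |A|` into a cosine polynomial `1/2 − c(1) − Σ_{k≥1} a_k cos(kφ) ≥ 0`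
with `a₁ = −½ Σ_{p∈S} (log p − c(p))₊/√p`, and use the Fejér bound `|a₁| ≤ 2·(1/2 − c(1)) ≤ 1`
(exact quadrature at roots of unity, adapted from the 2001 stockroom `Rh_WMagnificationY1_MagDeficit`);
composites and prime powers only enter `a_k`, `k ≥ 2`. [folklore] -/
theorem stub_deficitOfTorus :
    ∀ c : ℕ → ℝ, (∀ n, 0 ≤ c n) →
      (∀ S : Finset ℕ, (∀ p ∈ S, p.Prime) → ∀ φ : ℝ,
        ∑ A ∈ S.powerset, (c (∏ p ∈ A, p) - ArithmeticFunction.vonMangoldt (∏ p ∈ A, p)) /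
            Real.sqrt (∏ p ∈ A, (p : ℝ)) * (1 / 2) ^ A.card * Real.cos ((A.card : ℝ) * φ) ≤ 1 / 2) →
      ∀ σ : ℝ, 1 / 2 < σ →
        Summable (fun p : ℕ => if p.Prime then max (Real.log p - c p) 0 / (p : ℝ) ^ σ else 0) := by
  intro c hc hT σ hσ
  -- the dominating series at the scale `1/2`
  have hg0 : ∀ p : ℕ, 0 ≤ (if p.Prime then max (Real.log p - c p) 0 / Real.sqrt p else 0) := by
    intro p
    split
    · exact div_nonneg (le_max_right _ _) (Real.sqrt_nonneg _)
    · exact le_rfl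
  have hg : Summable (fun p : ℕ => if p.Prime then max (Real.log p - c p) 0 / Real.sqrt p else 0) := by
    refine summable_of_sum_le hg0 (c := 2) fun u => ?_
    classical
    rw [← Finset.sum_filter]
    exact sum_deficit_div_sqrt_le_two c hc hT _ fun p hp => (Finset.mem_filter.mp hp).2
  refine Summable.of_nonneg_of_le (fun p => ?_) (fun p => ?_) hg
  · split
    · exact div_nonneg (le_max_right _ _) (Real.rpow_nonneg (Nat.cast_nonneg p) σ)
    · exact le_rfl
  · by_cases hp : p.Prime
    · rw [if_pos hp, if_pos hp]
      have hp1 : (1 : ℝ) < (p : ℝ) := by exact_mod_cast hp.one_lt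
      have hppos : (0 : ℝ) < (p : ℝ) := by positivity
      have hs : Real.sqrt p ≤ (p : ℝ) ^ σ := by
        rw [Real.sqrt_eq_rpow]
        exact (Real.rpow_le_rpow_left_iff hp1).mpr (by linarith)
      exact div_le_div_of_nonneg_left (le_max_right _ _) (Real.sqrt_pos.mpr hppos) hs
    · rw [if_neg hp, if_neg hp]

end Summit.RiemannHypothesis.RiemannHypothesis.Theorems.SignConeConeMagnification

end
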